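import Summits.ValiantsHypothesis.ValiantsHypothesis.Theorems.DivisionGapZeroOneTransferIMMToSpanGraph

/-!
# Padding lemma for line `arborescence-span` (crux `ZeroOneTransfer`, stmt-ValiantsHypothesis-5066):
# `stub_immToSpan` — entries of labelled iterated matrix products, times ONE common nonzero factor,
# are positive projections of Jerrum–Snir's spanning-tree polynomial

Main file (supports the lead's skeleton of line `arborescence-span`, statement `IMMToSpan`; the
objects are defined in `…IMMToSpanDefs.lean`, proofs in `…IMMToSpanAux.lean`, `…IMMToSpanGraph.lean`).
For labelled matrices `M_0, …, M_{d-1}` over `ℝ≥0` on a finite index type `ι` (every entry a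
variable `X x` or a constant `C a`) there are `N = (d+1)·#ι·(d·#ι²+2) ≤ 4 (#ι + d + 1)^8`, one
nonzero positive projection `A` of `ST_N = stPoly ℝ≥0 N` and, for every `(s, t)`, a positive
projection `B_{s t}` of `ST_N` with `(M_0 ⋯ M_{d-1})_{s t} · A = B_{s t}`:

* `stV_labA` — the bouquet on the vertex type `VN ι d` (program nodes `(ℓ, i)`, `i ≠ i₀`, keep their
  relay arcs, everything else hangs on the root by unit arcs) has spanning-tree polynomial
  `W^{(d+1)(#ι-1)} =: A`, `W = 1 + Σ_{l,i,j} M l i j`, nonzero over `ℝ≥0` since `W` has constant term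
  `≥ 1` (`W_pow_ne_zero`);
* `B_{s t} := stV (labH M s t) = (M_0 ⋯ M_{d-1})_{s t} · A` (`stV_labH`, `list_prod_apply`);
* both are positive projections of `ST_N` (`isProjection_stV`; `labH_isLabel`, `labA_isLabel`); an
  empty `ι` is handled by the empty digraph (`A = 1`).

This un-normalised "padding" form of matrix-tree universality for branching programs (nearest
print: the Markov chain tree theorem) is elementary and proved here from scratch. [folklore]
-/

noncomputable section

namespace Summit.ValiantsHypothesis.ValiantsHypothesis.Theorems.DivisionGapZeroOneTransfer

-- the single-problem summit's namespace `Summit.ValiantsHypothesis.ValiantsHypothesis` repeats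
set_option linter.dupNamespace false

namespace IMMToSpan

open Literature.Computability.AlgebraicComplexity Literature.Barriers.ValiantsHypothesis
open MvPolynomial Finset

/-! ### The spanning-tree polynomial of the bouquet -/

section Bouquet

variable {ι : Type} {d : ℕ} [DecidableEq ι] {R : Type} [CommSemiring R] (M : Fin d → Matrix ι ι R)
  [Fintype ι]

/-- **The spanning-tree polynomial of the bouquet** is the padding factor `W^{(d+1)(#ι-1)}`.
[folklore] -/
theorem stV_labA (i₀ : ι) : stV (labA M i₀) = (W M ^ (Fintype.card ι - 1)) ^ (d + 1) := by
  rw [stV_eq_sum_of_param (labA M i₀) univ extA ?_ ?_ ?_]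
  rotate_left
  · intro c _ hw
    rw [mem_arbsV]
    refine ⟨fun v => match v with | .prog _ => 1 | .relay _ => 0, ?_⟩
    rintro (u | r) w hvw
    · change c u = some w at hvw
      have := label_ne_zero_of_wt_ne_zero hw (.prog u)
      change labA M i₀ (.prog u) (c u) ≠ 0 at this
      rw [hvw] at this
      rcases w with u' | r'
      · exact absurd (by simp [labA]) this
      · exact Nat.zero_lt_one
    · cases hvw
  · intro a _ b _ h
    exact funext fun u => congrFun h (.prog u)
  · intro T _ hw
    refine ⟨fun u => T (.prog u), Finset.mem_univ _, funext fun v => ?_⟩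
    rcases v with u | r
    · rfl
    · have := label_ne_zero_of_wt_ne_zero hw (.relay r)
      rcases hr : T (.relay r) with _ | w
      · rfl
      · rw [hr] at this
        exact absurd (by simp [labA]) this
  have hwt : ∀ c, wt (labA M i₀) (extA c) = ∏ u, labA M i₀ (.prog u) (c u) := by
    intro c
    unfold wt
    rw [prod_VN]
    have h1 : ∀ r, labA M i₀ (.relay r) (extA c (.relay r)) = 1 := fun r => by simp [extA, labA]
    simp only [h1, Finset.prod_const_one, mul_one]
    rfl
  simp_rw [hwt]
  rw [← Fintype.prod_sum]
  simp_rw [sum_labA_prog]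
  rw [Fintype.prod_prod_type]
  simp_rw [prod_ite_eq_mul_pow _ (fun _ => (1 : R))]
  rw [one_mul, Finset.prod_const, Finset.card_univ, Fintype.card_fin]

end Bouquet

/-! ### Labels and nonvanishing over `ℝ≥0` -/

section Labels

variable {ι : Type} {d : ℕ} {R : Type} [CommSemiring R] {τ : Type}
  (M : Fin d → Matrix ι ι (MvPolynomial τ R))
  (hM : ∀ l i j, (∃ x, M l i j = X x) ∨ ∃ a, M l i j = C a)
include hM

/-- Entry labels are labels. [folklore] -/
theorem lab₀_isLabel (o : Option (EN ι d)) : (∃ x, lab₀ M o = X x) ∨ ∃ a, lab₀ M o = C a := by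
  rcases o with _ | e
  · exact isLabel_one (R := R) (τ := τ)
  · exact hM _ _ _

variable [DecidableEq ι]

/-- The labels of `H_{s,t}` are labels. [folklore] -/
theorem labH_isLabel (s t : ι) (v : VN ι d) (o : Option (VN ι d)) :
    (∃ x, labH M s t v o = X x) ∨ ∃ a, labH M s t v o = C a := by
  have h0 := isLabel_zero (R := R) (τ := τ)
  have h1 := isLabel_one (R := R) (τ := τ)
  rcases v with u | r <;> rcases o with _ | (u' | r')
  · exact isLabel_ite h1 h0
  · exact h0
  · exact isLabel_ite (lab₀_isLabel M hM r'.2) h0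
  · exact h0
  · exact isLabel_ite h1 h0
  · have : labH M s t (.relay r) (some (.relay r')) = 0 := by simp [labH]
    rw [this]
    exact h0

/-- The labels of the bouquet are labels. [folklore] -/
theorem labA_isLabel (i₀ : ι) (v : VN ι d) (o : Option (VN ι d)) :
    (∃ x, labA M i₀ v o = X x) ∨ ∃ a, labA M i₀ v o = C a := by
  have h0 := isLabel_zero (R := R) (τ := τ)
  have h1 := isLabel_one (R := R) (τ := τ)
  rcases v with u | r <;> rcases o with _ | (u' | r')
  · exact isLabel_ite h1 h0
  · exact h0
  · exact isLabel_ite (lab₀_isLabel M hM r'.2) h0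
  · exact h1
  · exact h0
  · exact h0

end Labels

/-- Over `ℝ≥0` the padding factor is nonzero: `W` has constant term `≥ 1`. [folklore] -/
theorem W_pow_ne_zero {ι : Type} [Fintype ι] [DecidableEq ι] {d : ℕ} {τ : Type}
    (M : Fin d → Matrix ι ι (MvPolynomial τ NNReal)) (a b : ℕ) : (W M ^ a) ^ b ≠ 0 := by
  have hW : constantCoeff (W M) ≠ 0 := by
    unfold W
    rw [Fintype.sum_option, map_add]
    simp only [lab₀, map_one]
    exact ne_of_gt (lt_of_lt_of_le zero_lt_one le_self_add)
  intro h
  have := congrArg constantCoeff h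
  rw [map_pow, map_pow, map_zero] at this
  exact pow_ne_zero _ (pow_ne_zero _ hW) this

end IMMToSpan

/-! ### The stub -/

open Literature.Computability.AlgebraicComplexity Literature.Barriers.ValiantsHypothesis
open MvPolynomial Finset IMMToSpan

/-- **The padding lemma of line `arborescence-span`** (`stub_immToSpan` of the lead's skeleton,
statement `IMMToSpan`): for labelled matrices `M_1, …, M_d` over `ℝ≥0` on a finite index type `ι`
there are `N ≤ 4 (#ι + d + 1)^8` (here `N = (d+1)·#ι·(d·#ι²+2)`), ONE nonzero positive projection
`A = (1 + Σ_{l,i,j} M l i j)^{(d+1)(#ι-1)}` of `ST_N` (the bouquet) and, for every `(s, t)`, the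
positive projection `B = ST(H_{s,t})` of `ST_N` with `(M_1 ⋯ M_d)_{s t} · A = B`. [folklore] -/
theorem stub_immToSpan :
    ∀ (τ : Type) (ι : Type) [Fintype ι] [DecidableEq ι] (d : ℕ)
      (M : Fin d → Matrix ι ι (MvPolynomial τ NNReal)),
      (∀ l i j, (∃ x, M l i j = MvPolynomial.X x) ∨ (∃ a, M l i j = MvPolynomial.C a)) →
      ∃ N ≤ 4 * (Fintype.card ι + d + 1) ^ 8,
        ∃ A : MvPolynomial τ NNReal,
          Literature.Computability.AlgebraicComplexity.IsProjection A
              (Literature.Barriers.ValiantsHypothesis.stPoly NNReal N) ∧ A ≠ 0 ∧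
          ∀ s t : ι, ∃ B : MvPolynomial τ NNReal,
            Literature.Computability.AlgebraicComplexity.IsProjection B
                (Literature.Barriers.ValiantsHypothesis.stPoly NNReal N) ∧
            (List.ofFn M).prod s t * A = B := by
  intro τ ι _ _ d M hM
  refine ⟨Fintype.card (VN ι d), card_VN_le ι d, ?_⟩
  rcases isEmpty_or_nonempty ι with hι | ⟨⟨i₀⟩⟩
  · refine ⟨stV (V := VN ι d) (fun _ _ => 1), isProjection_stV _ (fun _ _ => isLabel_one), ?_,
      fun s => isEmptyElim s⟩
    have : IsEmpty (VN ι d) :=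
      ⟨fun v => by rcases v with ⟨_, i⟩ | ⟨⟨_, i⟩, _⟩ <;> exact isEmptyElim i⟩
    rw [stV_of_isEmpty]
    exact one_ne_zero
  · refine ⟨stV (labA M i₀), isProjection_stV _ (labA_isLabel M hM i₀), ?_, fun s t =>
      ⟨stV (labH M s t), isProjection_stV _ (labH_isLabel M hM s t), ?_⟩⟩
    · rw [stV_labA]
      exact W_pow_ne_zero M _ _
    · rw [stV_labH, stV_labA, list_prod_apply]

end Summit.ValiantsHypothesis.ValiantsHypothesis.Theorems.DivisionGapZeroOneTransfer
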